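import Summits.Ventures.PercRepro.C041TriDomMonotoneInjection

/-!
# ROW C-041 — GLUING AT A CUT VERTEX, I: SPLITTING A COLOURING INTO ITS TWO SIDES
(p6, gen 45; P6-TWOEXIT-LEAN.md §53 ADDENDUM 16)

The combinatorics of a colouring `ω : E₁ → Bool` split along a decidable edge predicate `In` (the edges of one
side of a cut vertex): `merge In o i` takes the `In`-edges from `i` and the others from `o`; `inN` / `outN` are the
two normalised parts (the other side blanked to blue), so that `merge In (outN ω) (inN ω) = ω`; `InSupp` / `OutSupp`
are the normalised colourings of each side.  The counting lemmas used by the gluing argument: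

* `card_filter_eq_sum_fibre`: `#{ω | P ω} = Σ_{i ∈ InSupp} #{o ∈ OutSupp | P (merge o i)}` — the colourings of the
  host are the pairs (outside part, inside part), by the bijection `ω ↦ (outN ω, inN ω)`;
* `card_filter_outOnly` / `card_filter_inOnly`: a predicate that depends on one side only counts
  `#(other side) · #(its side)`;
* the monotonicity of `merge`, `inN`, `outN` and the up-sets `fun ω => V (merge ω j)`, `fun ω => V (inN ω)`.
-/

namespace PercRepro

namespace ZoneZ

namespace MultiExit

open Finset

variable {E₁ : Type} [Fintype E₁] [DecidableEq E₁] (In : E₁ → Prop) [DecidablePred In]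

/-! ## Merging the two sides -/

/-- `merge In o i`: the `In`-edges coloured by `i`, the others by `o`. -/
def merge (o i : E₁ → Bool) : E₁ → Bool := fun e => if In e then i e else o e

/-- The inside part of a colouring: the `In`-edges kept, the others blue. -/
def inN (ω : E₁ → Bool) : E₁ → Bool := merge In (fun _ => false) ω

/-- The outside part of a colouring: the `In`-edges blue, the others kept. -/
def outN (ω : E₁ → Bool) : E₁ → Bool := merge In ω (fun _ => false)

/-- The normalised inside colourings (blue off `In`). -/
def InSupp : Finset (E₁ → Bool) := univ.filter fun i => ∀ e, ¬ In e → i e = false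

/-- The normalised outside colourings (blue on `In`). -/
def OutSupp : Finset (E₁ → Bool) := univ.filter fun o => ∀ e, In e → o e = false

omit [Fintype E₁] [DecidableEq E₁] in
/-- `merge` on an `In`-edge. -/
theorem merge_of_in (o i : E₁ → Bool) {e : E₁} (h : In e) : merge In o i e = i e := by
  simp [merge, h]

omit [Fintype E₁] [DecidableEq E₁] in
/-- `merge` off `In`. -/
theorem merge_of_not_in (o i : E₁ → Bool) {e : E₁} (h : ¬ In e) : merge In o i e = o e := by
  simp [merge, h]

omit [Fintype E₁] [DecidableEq E₁] in
/-- A colouring is the merge of its two parts. -/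
theorem merge_outN_inN (ω : E₁ → Bool) : merge In (outN In ω) (inN In ω) = ω := by
  funext e
  by_cases h : In e <;> simp [merge, inN, outN, h]

omit [Fintype E₁] [DecidableEq E₁] in
/-- The inside part of a merge is the inside part of its inside argument. -/
theorem inN_merge (o i : E₁ → Bool) : inN In (merge In o i) = inN In i := by
  funext e
  by_cases h : In e <;> simp [merge, inN, h]

omit [Fintype E₁] [DecidableEq E₁] in
/-- The outside part of a merge is the outside part of its outside argument. -/
theorem outN_merge (o i : E₁ → Bool) : outN In (merge In o i) = outN In o := by
  funext e
  by_cases h : In e <;> simp [merge, outN, h]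

omit [Fintype E₁] [DecidableEq E₁] in
/-- Merging with the outside part of `ω` is merging with `ω`. -/
theorem merge_outN_left (ω j : E₁ → Bool) : merge In (outN In ω) j = merge In ω j := by
  funext e
  by_cases h : In e <;> simp [merge, outN, h]

omit [Fintype E₁] [DecidableEq E₁] in
/-- Merging with the inside part of `ω` is merging with `ω`. -/
theorem merge_inN_right (o ω : E₁ → Bool) : merge In o (inN In ω) = merge In o ω := by
  funext e
  by_cases h : In e <;> simp [merge, inN, h]

/-- The inside part lies in `InSupp`. -/
theorem inN_mem_InSupp (ω : E₁ → Bool) : inN In ω ∈ InSupp In := by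
  simp only [InSupp, Finset.mem_filter, Finset.mem_univ, true_and]
  intro e he
  simp [inN, merge, he]

/-- The outside part lies in `OutSupp`. -/
theorem outN_mem_OutSupp (ω : E₁ → Bool) : outN In ω ∈ OutSupp In := by
  simp only [OutSupp, Finset.mem_filter, Finset.mem_univ, true_and]
  intro e he
  simp [outN, merge, he]

/-- A normalised inside colouring is its own inside part. -/
theorem inN_eq_self {i : E₁ → Bool} (hi : i ∈ InSupp In) : inN In i = i := by
  simp only [InSupp, Finset.mem_filter, Finset.mem_univ, true_and] at hi
  funext e
  by_cases h : In e
  · simp [inN, merge, h]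
  · simp [inN, merge, h, hi e h]

/-- A normalised outside colouring is its own outside part. -/
theorem outN_eq_self {o : E₁ → Bool} (ho : o ∈ OutSupp In) : outN In o = o := by
  simp only [OutSupp, Finset.mem_filter, Finset.mem_univ, true_and] at ho
  funext e
  by_cases h : In e
  · simp [outN, merge, h, ho e h]
  · simp [outN, merge, h]

/-- The merge of a normalised pair has those parts. -/
theorem outN_merge_of_mem {o i : E₁ → Bool} (ho : o ∈ OutSupp In) : outN In (merge In o i) = o := by
  rw [outN_merge, outN_eq_self In ho]

/-- The merge of a normalised pair has those parts. -/
theorem inN_merge_of_mem {o i : E₁ → Bool} (hi : i ∈ InSupp In) : inN In (merge In o i) = i := by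
  rw [inN_merge, inN_eq_self In hi]

/-- `InSupp` is non-empty: it contains the all-blue colouring. -/
theorem card_InSupp_pos : 0 < (InSupp In).card := by
  apply Finset.card_pos.mpr
  exact ⟨fun _ => false, by simp [InSupp]⟩

/-- `OutSupp` is non-empty: it contains the all-blue colouring. -/
theorem card_OutSupp_pos : 0 < (OutSupp In).card := by
  apply Finset.card_pos.mpr
  exact ⟨fun _ => false, by simp [OutSupp]⟩

/-! ## Counting along the fibres -/

/-- **THE FIBRE COUNT**: the colourings with a property are counted fibre by fibre over the inside parts. -/
theorem card_filter_eq_sum_fibre (P : (E₁ → Bool) → Prop) [DecidablePred P] :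
    (univ.filter P).card = ∑ i ∈ InSupp In, ((OutSupp In).filter fun o => P (merge In o i)).card := by
  have h : (univ.filter P).card = ((OutSupp In ×ˢ InSupp In).filter fun p => P (merge In p.1 p.2)).card := by
    refine Finset.card_nbij' (fun ω => (outN In ω, inN In ω)) (fun p => merge In p.1 p.2) ?_ ?_ ?_ ?_
    · intro ω hω
      simp only [Finset.coe_filter, Finset.mem_univ, true_and, Set.mem_setOf_eq, Finset.mem_product] at hω ⊢
      exact ⟨⟨outN_mem_OutSupp In ω, inN_mem_InSupp In ω⟩, by rw [merge_outN_inN]; exact hω⟩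
    · intro p hp
      simp only [Finset.coe_filter, Finset.mem_univ, true_and, Set.mem_setOf_eq, Finset.mem_product] at hp ⊢
      exact hp.2
    · intro ω _
      simp only
      exact merge_outN_inN In ω
    · intro p hp
      simp only [Finset.coe_filter, Finset.mem_product, Set.mem_setOf_eq] at hp
      simp only
      rw [outN_merge_of_mem In hp.1.1, inN_merge_of_mem In hp.1.2]
  rw [h, Finset.card_filter, Finset.sum_product_right]
  refine Finset.sum_congr rfl fun i _ => ?_
  rw [Finset.card_filter]

/-- A predicate depending only on the outside part counts `#InSupp · #{o ∈ OutSupp | P o}`. -/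
theorem card_filter_outOnly (P : (E₁ → Bool) → Prop) [DecidablePred P] (hP : ∀ ω, P ω ↔ P (outN In ω)) :
    (univ.filter P).card = (InSupp In).card * ((OutSupp In).filter P).card := by
  rw [card_filter_eq_sum_fibre In P]
  rw [Finset.sum_congr rfl fun i _ => ?_]
  · rw [Finset.sum_const, smul_eq_mul]
  · congr 1
    refine Finset.filter_congr fun o ho => ?_
    rw [hP (merge In o i), outN_merge_of_mem In ho]

/-- A predicate depending only on the inside part counts `#OutSupp · #{i ∈ InSupp | P i}`. -/
theorem card_filter_inOnly (P : (E₁ → Bool) → Prop) [DecidablePred P] (hP : ∀ ω, P ω ↔ P (inN In ω)) :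
    (univ.filter P).card = (OutSupp In).card * ((InSupp In).filter P).card := by
  rw [card_filter_eq_sum_fibre In P]
  have h : ∀ i ∈ InSupp In, ((OutSupp In).filter fun o => P (merge In o i)).card =
      if P i then (OutSupp In).card else 0 := by
    intro i hi
    have hc : ∀ o ∈ OutSupp In, P (merge In o i) ↔ P i := by
      intro o _
      rw [hP (merge In o i), inN_merge_of_mem In hi]
    by_cases hPi : P i
    · rw [if_pos hPi]
      congr 1
      exact Finset.filter_true_of_mem fun o ho => (hc o ho).mpr hPi
    · rw [if_neg hPi]
      rw [Finset.card_eq_zero]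
      exact Finset.filter_false_of_mem fun o ho => fun h => hPi ((hc o ho).mp h)
  rw [Finset.sum_congr rfl h, Finset.sum_ite, Finset.sum_const_zero, add_zero, Finset.sum_const, smul_eq_mul,
    mul_comm]

/-! ## Monotonicity -/

omit [Fintype E₁] [DecidableEq E₁] in
/-- `merge` is monotone in its outside argument. -/
theorem leCol_merge_left {o o' : E₁ → Bool} (h : LeCol o o') (i : E₁ → Bool) :
    LeCol (merge In o i) (merge In o' i) := by
  intro e he
  by_cases hi : In e
  · rwa [merge_of_in In _ _ hi] at he ⊢
  · rw [merge_of_not_in In _ _ hi] at he ⊢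
    exact h e he

omit [Fintype E₁] [DecidableEq E₁] in
/-- `merge` is monotone in its inside argument. -/
theorem leCol_merge_right (o : E₁ → Bool) {i i' : E₁ → Bool} (h : LeCol i i') :
    LeCol (merge In o i) (merge In o i') := by
  intro e he
  by_cases hi : In e
  · rw [merge_of_in In _ _ hi] at he ⊢
    exact h e he
  · rwa [merge_of_not_in In _ _ hi] at he ⊢

omit [Fintype E₁] [DecidableEq E₁] in
/-- The inside part is monotone. -/
theorem leCol_inN {ω ω' : E₁ → Bool} (h : LeCol ω ω') : LeCol (inN In ω) (inN In ω') :=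
  leCol_merge_right In _ h

omit [Fintype E₁] [DecidableEq E₁] in
/-- The outside part is monotone. -/
theorem leCol_outN {ω ω' : E₁ → Bool} (h : LeCol ω ω') : LeCol (outN In ω) (outN In ω') :=
  leCol_merge_left In h _

omit [Fintype E₁] [DecidableEq E₁] in
/-- The fibre of an up-set over an inside colouring is an up-set (in the outside colouring). -/
theorem upSet_fibreOut {V : (E₁ → Bool) → Prop} (hV : UpSet V) (j : E₁ → Bool) :
    UpSet fun ω => V (merge In ω j) := by
  intro ω ω' hω hle
  exact hV _ _ hω (leCol_merge_left In hle j)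

omit [Fintype E₁] [DecidableEq E₁] in
/-- The pull-back of an up-set along the inside part is an up-set. -/
theorem upSet_pullIn {V : (E₁ → Bool) → Prop} (hV : UpSet V) : UpSet fun ω => V (inN In ω) := by
  intro ω ω' hω hle
  exact hV _ _ hω (leCol_inN In hle)

omit [Fintype E₁] [DecidableEq E₁] in
/-- The pull-back of an up-set along the outside part is an up-set. -/
theorem upSet_pullOut {V : (E₁ → Bool) → Prop} (hV : UpSet V) : UpSet fun ω => V (outN In ω) := by
  intro ω ω' hω hle
  exact hV _ _ hω (leCol_outN In hle)

end MultiExit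

end ZoneZ

end PercRepro
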